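import Literature.NumberTheory.Sieve.SmoothProfileSums
import HarnessLib

/-!
# `W`-class profile weights: major-arc and minor-arc transfer, parity split

Topic `Literature/NumberTheory/Sieve`, namespace `Literature.NumberTheory.Sieve.SmoothArcs`; the PROVED sequel of
`SmoothProfileSums` ([Harper2016, §5], smoothed circle method over the `y`-friable integers `S(X, y)` with the
`W`-class profiles `p_c = Σ_ℓ c_ℓ W_ℓ`, `‖c‖_W = Σ_ℓ ‖c_ℓ‖(1+|ℓ|)³`).  With the notation of that file:

* `classProfileSum_arc'` (the arc identity with a free offset) and the trivial bounds
  `norm_classArcSum_le_floor`, `norm_smoothWeightSum_le_floor` (`≤ ⌊X⌋`, for the hypotheses `htriv`);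

* (P4) `classProfileSum_arc_transfer`: an abstract major-arc asymptotic
  `‖classArcSum(λ') − F·Ŵ_{λ'}(α)‖ ≤ A/(1+|λ'|) + B(1+|λ'|)³` for `|λ'| ≤ Λ`, a trivial bound `T` for all
  `classArcSum(λ')` and `‖F‖ ≤ T` give, for `|λ| ≤ Λ/2`,
  `‖classProfileSum(h/k + λ/X) − F·P̂_c(α;λ)‖ ≤ A Σ_ℓ‖c_ℓ‖(1+|ℓ|)/(1+|λ|) + B(1+|λ|)³‖c‖_W + 16 T ‖c‖_W/Λ³`;
* (P5) `norm_classProfileSum_one_le` (minor arcs, `m = 1`): a bound `M` for `S_w(θ'; X)` on `|θ'−θ| ≤ ρ`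
  and a trivial bound `T` give `‖classProfileSum X y 1 0 c θ‖ ≤ M Σ_ℓ‖c_ℓ‖ + T‖c‖_W/(ρX)³`;
* (P6) `filter_even_eq_image`, `sum_filter_odd_eq`, `classProfileSum_two_one`, `classArcSum_two_one`:
  the odd-class sums (`m = 2`, `r = 1`) are the full sums minus the full sums at scale `X/2` with doubled
  frequency (`y ≥ 2`, so that `2 ∈ S(y)`).

## References

* A. J. Harper, Compositio Math. 152 (2016), §5 (smooth weights on the major and minor arcs) [Harper2016].
-/

noncomputable section

open Finset Real Complex MeasureTheory
open scoped FourierTransform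

namespace Literature.NumberTheory.Sieve

namespace SmoothArcs

open TwistedWeight Endgame

variable {c : ℤ → ℂ}

/-! ### (P2') The arc identity with a free offset -/

/-- The arc identity `classProfileSum_arc` with a free offset `β` (`λ = βX`, `X ≠ 0`):
`classProfileSum X y m r c (h/k + β) = Σ_ℓ c_ℓ · classArcSum X y m r k h (βX + ℓ)`. [folklore] -/
theorem classProfileSum_arc' (hc' : Summable (fun ℓ : ℤ => ‖c ℓ‖)) {X : ℝ} (hX : X ≠ 0) (y m r k : ℕ) (h : ℤ)
    (β : ℝ) :
    classProfileSum X y m r c ((h : ℝ) / k + β) = ∑' ℓ : ℤ, c ℓ * classArcSum X y m r k h (β * X + ℓ) := by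
  have h1 := classProfileSum_arc hc' X y m r k h (β * X)
  rwa [mul_div_cancel_right₀ β hX] at h1

/-! ### Trivial bounds (for the hypotheses `htriv` below) -/

/-- `#S(X, y) ≤ ⌊X⌋` (`0 ∉ S(y)`). [folklore] -/
theorem card_smoothNumbersUpTo_le_floor (X : ℝ) (y : ℕ) :
    ((Nat.smoothNumbersUpTo ⌊X⌋₊ (y + 1)).card : ℝ) ≤ ⌊X⌋₊ := by
  have h : Nat.smoothNumbersUpTo ⌊X⌋₊ (y + 1) ⊆ Finset.Icc 1 ⌊X⌋₊ := by
    intro n hn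
    rw [Nat.mem_smoothNumbersUpTo] at hn
    exact Finset.mem_Icc.mpr ⟨Nat.pos_of_ne_zero (Nat.ne_zero_of_mem_smoothNumbers hn.2), hn.1⟩
  have h2 := Finset.card_le_card h
  rw [Nat.card_Icc] at h2
  exact_mod_cast (by omega : (Nat.smoothNumbersUpTo ⌊X⌋₊ (y + 1)).card ≤ ⌊X⌋₊)

/-- Trivial bound `‖classArcSum X y m r k h λ‖ ≤ ⌊X⌋` (each term has norm `≤ 1`). [folklore] -/
theorem norm_classArcSum_le_floor (X : ℝ) (y m r k : ℕ) (h : ℤ) (lam : ℝ) :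
    ‖classArcSum X y m r k h lam‖ ≤ ⌊X⌋₊ := by
  unfold classArcSum
  set S := (Nat.smoothNumbersUpTo ⌊X⌋₊ (y + 1)).filter (fun n => n ≡ r [MOD m])
  calc ‖∑ n ∈ S, (𝐞 ((h * n : ℝ) / k) : ℂ) * twistWeight lam (n / X)‖
      ≤ ∑ n ∈ S, ‖(𝐞 ((h * n : ℝ) / k) : ℂ) * twistWeight lam (n / X)‖ := norm_sum_le _ _
    _ ≤ ∑ n ∈ S, (1 : ℝ) := Finset.sum_le_sum fun n _ => by
        rw [norm_mul, Circle.norm_coe, one_mul]; exact norm_twistWeight_le _ _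
    _ = S.card := by simp
    _ ≤ (Nat.smoothNumbersUpTo ⌊X⌋₊ (y + 1)).card := by exact_mod_cast Finset.card_filter_le _ _
    _ ≤ ⌊X⌋₊ := card_smoothNumbersUpTo_le_floor X y

/-- Trivial bound `‖S_w(θ; X)‖ ≤ ⌊X⌋` (each term has norm `≤ 1`). [folklore] -/
theorem norm_smoothWeightSum_le_floor (X : ℝ) (y : ℕ) (θ : ℝ) : ‖smoothWeightSum X y θ‖ ≤ ⌊X⌋₊ := by
  unfold smoothWeightSum
  set S := Nat.smoothNumbersUpTo ⌊X⌋₊ (y + 1)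
  calc ‖∑ n ∈ S, (wt (n / X) : ℂ) * (𝐞 ((n : ℝ) * θ) : ℂ)‖
      ≤ ∑ n ∈ S, ‖(wt (n / X) : ℂ) * (𝐞 ((n : ℝ) * θ) : ℂ)‖ := norm_sum_le _ _
    _ ≤ ∑ n ∈ S, (1 : ℝ) := Finset.sum_le_sum fun n hn => by
        obtain ⟨h0, h1⟩ := div_mem_Ioc_of_mem hn
        rw [norm_mul, Circle.norm_coe, mul_one, Complex.norm_real, Real.norm_eq_abs, abs_of_nonneg (wt_nonneg _)]
        exact wt_le_one h0.le h1
    _ = S.card := by simp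
    _ ≤ ⌊X⌋₊ := card_smoothNumbersUpTo_le_floor X y

/-! ### (P4) Major-arc transfer -/

/-- **Arc transfer.** Suppose that on `|λ'| ≤ Λ` the single-weight class sums satisfy
`‖classArcSum(λ') − F Ŵ_{λ'}(α)‖ ≤ A/(1+|λ'|) + B(1+|λ'|)³`, that `‖classArcSum(λ')‖ ≤ T` for all `λ'` and
`‖F‖ ≤ T` (`A, B ≥ 0`, `α ≥ 0`, `Λ > 0`).  Then for `|λ| ≤ Λ/2`,
`‖classProfileSum(h/k + λ/X) − F P̂_c(α; λ)‖ ≤ A Σ_ℓ‖c_ℓ‖(1+|ℓ|)/(1+|λ|) + B(1+|λ|)³‖c‖_W + 16 T ‖c‖_W/Λ³`: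
split `ℓ` according to `|λ+ℓ| ≤ Λ` (use the hypothesis, `1/(1+|λ+ℓ|) ≤ (1+|ℓ|)/(1+|λ|)`,
`(1+|λ+ℓ|)³ ≤ (1+|λ|)³(1+|ℓ|)³`) or `|λ+ℓ| > Λ` (then `|ℓ| > Λ/2`, so `2T ≤ 16 T (1+|ℓ|)³/Λ³`). [folklore] -/
theorem classProfileSum_arc_transfer (hc : Summable (fun ℓ : ℤ => ‖c ℓ‖ * (1 + |(ℓ : ℝ)|) ^ 3))
    {X : ℝ} {y m r k : ℕ} {h : ℤ} {Λ lam α A B T : ℝ} {F : ℂ} (hΛ : 0 < Λ) (hlam : |lam| ≤ Λ / 2)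
    (hA : 0 ≤ A) (hB : 0 ≤ B) (hα : 0 ≤ α)
    (harc : ∀ lam' : ℝ, |lam'| ≤ Λ →
      ‖classArcSum X y m r k h lam' - F * twistMellin lam' α‖ ≤ A / (1 + |lam'|) + B * (1 + |lam'|) ^ 3)
    (htriv : ∀ lam' : ℝ, ‖classArcSum X y m r k h lam'‖ ≤ T) (hF : ‖F‖ ≤ T) :
    ‖classProfileSum X y m r c ((h : ℝ) / k + lam / X) - F * profileMellin c α lam‖ ≤
      A * (∑' ℓ : ℤ, ‖c ℓ‖ * (1 + |(ℓ : ℝ)|)) / (1 + |lam|) + B * (1 + |lam|) ^ 3 * profileNorm c +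
        16 * T * profileNorm c / Λ ^ 3 := by
  have hc' := summable_norm_of_cube hc
  have hT : 0 ≤ T := (norm_nonneg F).trans hF
  have hs : 0 ≤ ((α : ℂ)).re := by simpa using hα
  have hpos : 0 < 1 + |lam| := by positivity
  -- `1 + |λ+ℓ| ≤ (1+|λ|)(1+|ℓ|)` and `1 + |λ| ≤ (1+|λ+ℓ|)(1+|ℓ|)` (also `HuxleyZeroDetection.one_add_abs_add_le`,
  -- `ZetaSqReflectionPrinciple.one_add_abs_le_mul`, not imported here)
  have hadd : ∀ l : ℝ, 1 + |lam + l| ≤ (1 + |lam|) * (1 + |l|) := by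
    intro l
    have h1 := abs_add_le lam l
    nlinarith [abs_nonneg lam, abs_nonneg l, mul_nonneg (abs_nonneg lam) (abs_nonneg l)]
  have hkey : ∀ l : ℝ, 1 + |lam| ≤ (1 + |lam + l|) * (1 + |l|) := by
    intro l
    have h3 : |lam| ≤ |lam + l| + |l| := by
      have h4 := abs_add_le (lam + l) (-l)
      rwa [add_neg_cancel_right, abs_neg] at h4
    nlinarith [abs_nonneg (lam + l), abs_nonneg l, mul_nonneg (abs_nonneg (lam + l)) (abs_nonneg l)]
  -- the difference as one series `Σ_ℓ c_ℓ D_ℓ`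
  set D : ℤ → ℂ := fun ℓ => classArcSum X y m r k h (lam + ℓ) - F * twistMellin (lam + ℓ) α with hD
  have hsum1 : Summable (fun ℓ : ℤ => c ℓ * classArcSum X y m r k h (lam + ℓ)) := by
    refine Summable.of_norm_bounded (hc'.mul_left T) (fun ℓ => ?_)
    rw [norm_mul, mul_comm]
    exact mul_le_mul_of_nonneg_right (htriv _) (norm_nonneg _)
  have hsum2 : Summable (fun ℓ : ℤ => F * (c ℓ * twistMellin (lam + ℓ) α)) :=
    (summable_mul_twistMellin hc' hs lam).mul_left F
  have heq : classProfileSum X y m r c ((h : ℝ) / k + lam / X) - F * profileMellin c α lam =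
      ∑' ℓ : ℤ, c ℓ * D ℓ := by
    rw [classProfileSum_arc hc', profileMellin, ← tsum_mul_left, ← Summable.tsum_sub hsum1 hsum2]
    exact tsum_congr fun ℓ => by rw [hD]; ring
  rw [heq]
  -- the termwise majorant
  set g : ℤ → ℝ := fun ℓ => A / (1 + |lam|) * (‖c ℓ‖ * (1 + |(ℓ : ℝ)|)) +
    B * (1 + |lam|) ^ 3 * (‖c ℓ‖ * (1 + |(ℓ : ℝ)|) ^ 3) + 16 * T / Λ ^ 3 * (‖c ℓ‖ * (1 + |(ℓ : ℝ)|) ^ 3) with hg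
  have hgsum : HasSum g (A / (1 + |lam|) * (∑' ℓ : ℤ, ‖c ℓ‖ * (1 + |(ℓ : ℝ)|)) +
      B * (1 + |lam|) ^ 3 * profileNorm c + 16 * T / Λ ^ 3 * profileNorm c) :=
    (((summable_norm_mul_of_cube hc).hasSum.mul_left _).add (hc.hasSum.mul_left _)).add (hc.hasSum.mul_left _)
  have hbound : ∀ ℓ : ℤ, ‖c ℓ * D ℓ‖ ≤ g ℓ := by
    intro ℓ
    rw [norm_mul, hg]
    have h1 : 0 ≤ A / (1 + |lam|) * (‖c ℓ‖ * (1 + |(ℓ : ℝ)|)) := by positivity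
    have h2 : 0 ≤ B * (1 + |lam|) ^ 3 * (‖c ℓ‖ * (1 + |(ℓ : ℝ)|) ^ 3) := by positivity
    have h3 : 0 ≤ 16 * T / Λ ^ 3 * (‖c ℓ‖ * (1 + |(ℓ : ℝ)|) ^ 3) := by positivity
    rcases le_or_gt |lam + ℓ| Λ with hin | hout
    · -- `|λ + ℓ| ≤ Λ`: the arc hypothesis
      have hd : ‖D ℓ‖ ≤ A / (1 + |lam|) * (1 + |(ℓ : ℝ)|) + B * (1 + |lam|) ^ 3 * (1 + |(ℓ : ℝ)|) ^ 3 := by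
        refine (harc _ hin).trans (add_le_add ?_ ?_)
        · rw [div_mul_eq_mul_div, div_le_div_iff₀ (by positivity) hpos]
          have := hkey ℓ
          exact le_of_le_of_eq (mul_le_mul_of_nonneg_left this hA) (by ring)
        · rw [mul_assoc, ← mul_pow]
          exact mul_le_mul_of_nonneg_left (pow_le_pow_left₀ (by positivity) (hadd ℓ) 3) hB
      calc ‖c ℓ‖ * ‖D ℓ‖ ≤ ‖c ℓ‖ * (A / (1 + |lam|) * (1 + |(ℓ : ℝ)|) + B * (1 + |lam|) ^ 3 * (1 + |(ℓ : ℝ)|) ^ 3) :=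
            mul_le_mul_of_nonneg_left hd (norm_nonneg _)
        _ = A / (1 + |lam|) * (‖c ℓ‖ * (1 + |(ℓ : ℝ)|)) + B * (1 + |lam|) ^ 3 * (‖c ℓ‖ * (1 + |(ℓ : ℝ)|) ^ 3) := by
            ring
        _ ≤ _ := by linarith
    · -- `|λ + ℓ| > Λ`: trivial bounds, `|ℓ| > Λ/2`
      have hd : ‖D ℓ‖ ≤ 2 * T := by
        calc ‖D ℓ‖ ≤ ‖classArcSum X y m r k h (lam + ℓ)‖ + ‖F * twistMellin (lam + ℓ) α‖ := norm_sub_le _ _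
          _ ≤ T + T * 1 := by
              rw [norm_mul]
              exact add_le_add (htriv _) (mul_le_mul hF (norm_twistMellin_le_one hs _) (norm_nonneg _) hT)
          _ = 2 * T := by ring
      have hℓ : Λ ≤ 2 * (1 + |(ℓ : ℝ)|) := by
        have := abs_add_le lam (ℓ : ℝ)
        linarith
      have hΛ3 : Λ ^ 3 ≤ 8 * (1 + |(ℓ : ℝ)|) ^ 3 := by
        calc Λ ^ 3 ≤ (2 * (1 + |(ℓ : ℝ)|)) ^ 3 := pow_le_pow_left₀ hΛ.le hℓ 3
          _ = 8 * (1 + |(ℓ : ℝ)|) ^ 3 := by ring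
      have h4 : ‖c ℓ‖ * (2 * T) ≤ 16 * T / Λ ^ 3 * (‖c ℓ‖ * (1 + |(ℓ : ℝ)|) ^ 3) := by
        rw [div_mul_eq_mul_div, le_div_iff₀ (pow_pos hΛ 3)]
        have := mul_le_mul_of_nonneg_left hΛ3 (by positivity : 0 ≤ 2 * T * ‖c ℓ‖)
        linarith
      calc ‖c ℓ‖ * ‖D ℓ‖ ≤ ‖c ℓ‖ * (2 * T) := mul_le_mul_of_nonneg_left hd (norm_nonneg _)
        _ ≤ _ := by linarith
  refine (tsum_of_norm_bounded hgsum hbound).trans (le_of_eq ?_)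
  ring

/-! ### (P5) Minor-arc transfer (`m = 1`) -/

/-- **Minor-arc transfer.** If `‖S_w(θ'; X)‖ ≤ M` for `|θ' − θ| ≤ ρ` and `‖S_w(θ'; X)‖ ≤ T` for all `θ'`
(`ρ, X > 0`), then `‖classProfileSum X y 1 0 c θ‖ ≤ M Σ_ℓ‖c_ℓ‖ + T‖c‖_W/(ρX)³`
(the terms `|ℓ| ≤ ρX` see `M`; the others have `(ρX)³ ≤ (1+|ℓ|)³`). [folklore] -/
theorem norm_classProfileSum_one_le (hc : Summable (fun ℓ : ℤ => ‖c ℓ‖ * (1 + |(ℓ : ℝ)|) ^ 3)) {X : ℝ}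
    (hX : 0 < X) (y : ℕ) {θ ρ M T : ℝ} (hρ : 0 < ρ)
    (hminor : ∀ θ' : ℝ, |θ' - θ| ≤ ρ → ‖smoothWeightSum X y θ'‖ ≤ M)
    (htriv : ∀ θ' : ℝ, ‖smoothWeightSum X y θ'‖ ≤ T) :
    ‖classProfileSum X y 1 0 c θ‖ ≤ M * (∑' ℓ : ℤ, ‖c ℓ‖) + T * profileNorm c / (ρ * X) ^ 3 := by
  have hc' := summable_norm_of_cube hc
  have hM : 0 ≤ M := (norm_nonneg _).trans (hminor θ (by rw [sub_self, abs_zero]; exact hρ.le))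
  have hT : 0 ≤ T := (norm_nonneg _).trans (htriv θ)
  have hρX : 0 < ρ * X := mul_pos hρ hX
  rw [classProfileSum_one_eq hc']
  set g : ℤ → ℝ := fun ℓ => M * ‖c ℓ‖ + T / (ρ * X) ^ 3 * (‖c ℓ‖ * (1 + |(ℓ : ℝ)|) ^ 3) with hg
  have hgsum : HasSum g (M * (∑' ℓ : ℤ, ‖c ℓ‖) + T / (ρ * X) ^ 3 * profileNorm c) :=
    (hc'.hasSum.mul_left M).add (hc.hasSum.mul_left _)
  have hbound : ∀ ℓ : ℤ, ‖c ℓ * smoothWeightSum X y (θ + ℓ / X)‖ ≤ g ℓ := by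
    intro ℓ
    rw [norm_mul, hg]
    have h1 : 0 ≤ M * ‖c ℓ‖ := by positivity
    have h2 : 0 ≤ T / (ρ * X) ^ 3 * (‖c ℓ‖ * (1 + |(ℓ : ℝ)|) ^ 3) := by positivity
    rcases le_or_gt |(ℓ : ℝ)| (ρ * X) with hin | hout
    · have hθ : |θ + ℓ / X - θ| ≤ ρ := by
        rw [add_sub_cancel_left, abs_div, abs_of_pos hX, div_le_iff₀ hX]
        exact hin
      calc ‖c ℓ‖ * ‖smoothWeightSum X y (θ + ℓ / X)‖ ≤ ‖c ℓ‖ * M :=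
            mul_le_mul_of_nonneg_left (hminor _ hθ) (norm_nonneg _)
        _ = M * ‖c ℓ‖ := mul_comm _ _
        _ ≤ _ := by linarith
    · have h3 : (ρ * X) ^ 3 ≤ (1 + |(ℓ : ℝ)|) ^ 3 := pow_le_pow_left₀ hρX.le (by linarith) 3
      have h4 : ‖c ℓ‖ * T ≤ T / (ρ * X) ^ 3 * (‖c ℓ‖ * (1 + |(ℓ : ℝ)|) ^ 3) := by
        rw [div_mul_eq_mul_div, le_div_iff₀ (pow_pos hρX 3)]
        have := mul_le_mul_of_nonneg_left h3 (by positivity : 0 ≤ T * ‖c ℓ‖)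
        linarith
      calc ‖c ℓ‖ * ‖smoothWeightSum X y (θ + ℓ / X)‖ ≤ ‖c ℓ‖ * T :=
            mul_le_mul_of_nonneg_left (htriv _) (norm_nonneg _)
        _ ≤ _ := by linarith
  refine (tsum_of_norm_bounded hgsum hbound).trans (le_of_eq ?_)
  ring

/-! ### (P6) Parity split -/

/-- The even members of `S(X, y)` are `2 · S(X/2, y)` (`y ≥ 2`). [folklore] -/
theorem filter_even_eq_image {X : ℝ} {y : ℕ} (hy : 2 ≤ y) :
    (Nat.smoothNumbersUpTo ⌊X⌋₊ (y + 1)).filter (fun n => n ≡ 0 [MOD 2]) =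
      (Nat.smoothNumbersUpTo ⌊X / 2⌋₊ (y + 1)).image (fun n => 2 * n) := by
  ext n
  simp only [Finset.mem_filter, Finset.mem_image, Nat.mem_smoothNumbersUpTo]
  constructor
  · rintro ⟨⟨hnx, hnS⟩, h2⟩
    obtain ⟨n', rfl⟩ := Nat.modEq_zero_iff_dvd.mp h2
    refine ⟨n', ⟨?_, Nat.mem_smoothNumbers_of_dvd hnS (dvd_mul_left n' 2)⟩, rfl⟩
    rw [Nat.floor_div_ofNat]
    omega
  · rintro ⟨n', ⟨hn'x, hn'S⟩, rfl⟩
    refine ⟨⟨?_, Nat.mul_mem_smoothNumbers (Nat.mem_smoothNumbers_of_lt two_pos (by omega)) hn'S⟩,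
      Nat.modEq_zero_iff_dvd.mpr (dvd_mul_right 2 n')⟩
    rw [Nat.floor_div_ofNat] at hn'x
    omega

/-- **Odd = all − even**: for `f : ℕ → ℂ` and `y ≥ 2`,
`Σ_{n ∈ S(X,y), n odd} f(n) = Σ_{n ∈ S(X,y)} f(n) − Σ_{n' ∈ S(X/2,y)} f(2n')` (the `m = 1` sums written with their
trivial class filter, as in `classProfileSum · · 1 0`, `classArcSum · · 1 0`). [folklore] -/
theorem sum_filter_odd_eq {X : ℝ} {y : ℕ} (hy : 2 ≤ y) (f : ℕ → ℂ) :
    ∑ n ∈ (Nat.smoothNumbersUpTo ⌊X⌋₊ (y + 1)).filter (fun n => n ≡ 1 [MOD 2]), f n =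
      ∑ n ∈ (Nat.smoothNumbersUpTo ⌊X⌋₊ (y + 1)).filter (fun n => n ≡ 0 [MOD 1]), f n -
        ∑ n ∈ (Nat.smoothNumbersUpTo ⌊X / 2⌋₊ (y + 1)).filter (fun n => n ≡ 0 [MOD 1]), f (2 * n) := by
  rw [Finset.filter_true_of_mem (fun n _ => (Nat.modEq_one : n ≡ 0 [MOD 1])),
    Finset.filter_true_of_mem (fun n _ => (Nat.modEq_one : n ≡ 0 [MOD 1])), eq_sub_iff_add_eq,
    ← Finset.sum_image (g := fun n : ℕ => 2 * n) (fun a _ b _ hab => Nat.eq_of_mul_eq_mul_left two_pos hab), ← filter_even_eq_image hy]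
  rw [← Finset.sum_filter_add_sum_filter_not (Nat.smoothNumbersUpTo ⌊X⌋₊ (y + 1)) (fun n => n ≡ 1 [MOD 2]) f]
  congr 1
  refine Finset.sum_congr (Finset.filter_congr fun n _ => ?_) fun _ _ => rfl
  unfold Nat.ModEq
  omega

/-- **Parity split for profile sums** (`y ≥ 2`):
`classProfileSum X y 2 1 c θ = classProfileSum X y 1 0 c θ − classProfileSum (X/2) y 1 0 c (2θ)`
(`p_c(2n'/X) = p_c(n'/(X/2))`, `e(2n'θ) = e(n'(2θ))`). [folklore] -/
theorem classProfileSum_two_one {y : ℕ} (hy : 2 ≤ y) (X : ℝ) (c : ℤ → ℂ) (θ : ℝ) :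
    classProfileSum X y 2 1 c θ = classProfileSum X y 1 0 c θ - classProfileSum (X / 2) y 1 0 c (2 * θ) := by
  unfold classProfileSum
  rw [sum_filter_odd_eq hy]
  congr 1
  refine Finset.sum_congr rfl fun n _ => ?_
  rw [show ((2 * n : ℕ) : ℝ) = 2 * (n : ℝ) by push_cast; ring]
  rw [show 2 * (n : ℝ) / X = n / (X / 2) by ring, show 2 * (n : ℝ) * θ = n * (2 * θ) by ring]

/-- **Parity split for arc sums** (`y ≥ 2`): `classArcSum X y 2 1 k h λ =
classArcSum X y 1 0 k h λ − classArcSum (X/2) y 1 0 k (2h) λ` (`e(h·2n'/k) = e((2h)n'/k)`,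
`W_λ(2n'/X) = W_λ(n'/(X/2))`). [folklore] -/
theorem classArcSum_two_one {y : ℕ} (hy : 2 ≤ y) (X : ℝ) (k : ℕ) (h : ℤ) (lam : ℝ) :
    classArcSum X y 2 1 k h lam = classArcSum X y 1 0 k h lam - classArcSum (X / 2) y 1 0 k (2 * h) lam := by
  unfold classArcSum
  rw [sum_filter_odd_eq hy]
  congr 1
  refine Finset.sum_congr rfl fun n _ => ?_
  rw [show ((2 * n : ℕ) : ℝ) = 2 * (n : ℝ) by push_cast; ring, show ((2 * h : ℤ) : ℝ) = 2 * (h : ℝ) by push_cast; ring]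
  rw [show 2 * (n : ℝ) / X = n / (X / 2) by ring, show (h : ℝ) * (2 * (n : ℝ)) / k = 2 * (h : ℝ) * n / k by ring]

end SmoothArcs

end Literature.NumberTheory.Sieve

end
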